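import Literature.NumberTheory.Automorphic.CDTTheorem712
import Literature.NumberTheory.EllipticCurves.ModFiveCongruenceHesseFamily
import Literature.NumberTheory.EllipticCurves.LeadingTermBSZOrdinaryProofs
import Literature.NumberTheory.EllipticCurves.CongruentNumberCurveJacobiSums
import Literature.NumberTheory.EllipticCurves.GlobalMinimalModelProofs
import Literature.NumberTheory.GaloisRepresentations.AbsGaloisGroup
import Literature.NumberTheory.EllipticCurves.WeilPairingProofs
import Literature.NumberTheory.EllipticCurves.DivisionField
import Mathlib.NumberTheory.LSeries.PrimesInAP
import HarnessLib

/-!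
# stub-ideation k3, generation 4 — `stub_switch` (= `CDT_three_five_switch`):
# the twisted-`1728` core of generation 3 + an ORDER-8 FROBENIUS TAIL read off Gauss's point count

Generation 3 (`…StubSwitchK3g3`, crux dir, rc 0) PROVED the core
`exists_fixed_root_1728 : Thm132iiMemHesseFamily → (T0,T1,T2,G4″) → Core1728`: for every integral
`c₄c₆`-model `E♭` with `c₆ ≠ 0` there are `τ ∈ Γ_ℚ` (negating `√-3`, fixing `μ₄`) and a `τ`-fixed
root `t₁ ∈ ℚ̄` of Fisher's `𝔠₆(·,1)` off the cusps — whatever the reduction of `E` at `3`.  Its tail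
then went `G3 (Chebotarev) → G2 → G1a/G1 (Ψ₃(E_t) irreducible over 𝔽_ℓ, over ℚ) → Fisher (i) →
helperB (Rubin's 55-subgroup census)`.

Generation 4 keeps the core verbatim (here the single hypothesis `Core1728`) and REPLACES the three
tail helpers G1a (S), G1 (M), helperB (M/L) by ONE small lemma N3 and the k1-shared certificate F2:

* at the Chebotarev prime `ℓ ≡ 5 (mod 12)` the member `E_t` (`t ≡ t₁`) reduces to `y² = x³ + āx`,
  `ā ≠ 0` (`j ≡ 1728`), and by GAUSS'S COUNT (Ireland–Rosen 18 §4 Thm 5, tree PROVED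
  `IrelandRosen1990_card_points_one_mod_four_holds`) `#Ē(𝔽_ℓ) = ℓ + 1 − 2 Re π'` with
  `π' ∈ ℤ[i]`, `N(π') = ℓ ≡ 2 (mod 3)`, so `3 ∤ Re π'` and **`3 ∤ #Ē(𝔽_ℓ)`**, i.e. `a_ℓ ≢ 0 (mod 3)`
  (N3, PROVED below);
* the tree's PROVED `BSZLemma17.frobeniusTrace_eq_of_smul_eq_shortWeierstrass` transports this to
  `a_ℓ` of a global minimal model (no `member_reduction` helper needed), and
  `hasGoodReductionAtPrime_shortWeierstrass_of_not_dvd_Δ` gives good reduction at `ℓ`;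
* F2 (`FrobeniusCertificate`, k1's gen-2 atom, M): `ℓ ≡ 2 (3)`, good, `3 ∤ a_ℓ` ⇒ `Frob_ℓ` has
  `det = -1`, `tr ≠ 0` in `GL₂(𝔽₃)` ⇒ order `8` ⇒ every framed `ρ̄_{E',3}` is absolutely irreducible
  on `Γ_{ℚ(√-3)}` (tree PROVED `Theorems.isAbsIrreducibleOverSqrt_negThree_of_orderOf_eq_eight`,
  `trace/det_galoisRepTorsion_frobenius_eq`).

`lean check`: sorries ONLY in the helper statements G3, G2, G6a, G6b (and the two `def … : Prop`
atoms `Core1728`, `FrobeniusCertificate` are hypotheses); N3, T3, the tail and the assembly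
`stub_switch_of_core_and_tail : Fisher (i) → Core1728 → FrobeniusCertificate → CDT_three_five_switch`
are kernel-checked.  The stub's three standing hypotheses are never used.
-/

namespace Summit.ABC.ABC.Cruxes.FreyModularity.StubSwitchK3g4

open Literature.NumberTheory.EllipticCurves Literature.NumberTheory.EllipticCurves.HesseFamilyFive
open Literature.NumberTheory.EllipticCurves.BSZLemma17
open Literature.NumberTheory.Automorphic Literature.NumberTheory.GaloisRepresentations
open Literature.NumberTheory.Automorphic.BCDT WeierstrassCurve

noncomputable section

/-! ## §1 Objects (verbatim from generations 2/3) -/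

/-- Fisher's Hesse member `E_{l,m} : y² = x³ − 27𝔠₄(l,m)x − 54𝔠₆(l,m)` over `(c₄, c₆)`. -/
abbrev member (c₄ c₆ l m : ℚ) : WeierstrassCurve ℚ :=
  ⟨0, 0, 0, -27 * C4 c₄ c₆ l m, -54 * C6 c₄ c₆ l m⟩

/-- The `c₄c₆`-model `y² = x³ − 27c₄x − 54c₆` (= the member at `(l:m) = (1:0)`). -/
abbrev base (c₄ c₆ : ℚ) : WeierstrassCurve ℚ := ⟨0, 0, 0, -27 * c₄, -54 * c₆⟩

/-- PROVED (gen 1): transport of a framed `5`-torsion model along a `5`-congruence. -/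
theorem isTorsionGaloisRep_of_congr {W W' : WeierstrassCurve ℚ} (h : Congr W' W)
    {ρ : ModPGaloisRep ℚ (ZMod 5) 2} (hρ : W.IsTorsionGaloisRep 5 ρ) :
    W'.IsTorsionGaloisRep 5 ρ := by
  obtain ⟨e', he'⟩ := h
  obtain ⟨e, he⟩ := hρ
  refine ⟨e'.trans e, fun σ P => ?_⟩
  rw [AddEquiv.trans_apply, AddEquiv.trans_apply, he', he]

/-- PROVED (k1-g3): a nonzero integer of absolute value below `q` is not divisible by `q`. -/
theorem not_dvd_of_natAbs_lt {q : ℕ} {z : ℤ} (hz : z ≠ 0) (hlt : z.natAbs < q) : ¬ (q : ℤ) ∣ z := by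
  intro h
  have h1 : q ∣ z.natAbs := by
    rcases h with ⟨k, hk⟩
    exact ⟨k.natAbs, by rw [hk, Int.natAbs_mul, Int.natAbs_natCast]⟩
  exact absurd (Nat.le_of_dvd (Int.natAbs_pos.mpr hz) h1) (not_le.mpr hlt)

/-! ## §2 The generation-3 CORE as one hypothesis

`Core1728` is the conclusion of g3's kernel-checked `exists_fixed_root_1728`
(`STUB_IDEAS_stub_switch_3g3_Sketch.lean`, l.472) with ONE re-cut — the off-cusp clause is
`𝔠₄(t₁,1) ≠ 0` (what G3 consumes; for a `j = 1728` member it is `c₄(E') ≠ 0`, sparing G4″ the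
degree-`60` syzygy `𝔠₄³ − 𝔠₆² = (c₄³−c₆²)𝔇⁵`) instead of `𝔇(t₁,1) ≠ 0`; g3 derives it from T0
`exists_inertial_elt` (M), T1 `smul_torsion_E₉` (M), T2 `smul_smul_torsion_Em₃` (M), G4″
`exists_root_C6_fixed_of_conj` (L → re-cut over a finite level, see the plan) and the named fact
`Thm132iiMemHesseFamily` (Fisher 13.2 (ii) over `K ⊆ ℚ̄`), through the PROVED finite-group lemmas
F1–F4 (`SL₂(𝔽₅) = 2I`: `b¹⁵ ∈ {1, -1, order 4}`, one class of order-`4` elements). -/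
def Core1728 : Prop :=
  ∀ (c₄ c₆ : ℤ), c₄ ^ 3 ≠ c₆ ^ 2 → c₆ ≠ 0 →
    ∃ (τ : Field.absoluteGaloisGroup ℚ) (t₁ : AlgebraicClosure ℚ),
      (∀ s : AlgebraicClosure ℚ, s ^ 2 = -3 → τ • s = -s) ∧
      (∀ z : AlgebraicClosure ℚ, z ^ 4 = 1 → τ • z = z) ∧
      C6 (c₄ : AlgebraicClosure ℚ) c₆ t₁ 1 = 0 ∧ C4 (c₄ : AlgebraicClosure ℚ) c₆ t₁ 1 ≠ 0 ∧
      τ • t₁ = t₁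

/-! ## §3 Helpers -/

/-- T3 (PROVED, verbatim g3): `τ ζ₁₂ = ζ₁₂⁵` for `τ` negating `√-3` and fixing `μ₄`. -/
theorem smul_zeta12 (τ : Field.absoluteGaloisGroup ℚ)
    (hs : ∀ s : AlgebraicClosure ℚ, s ^ 2 = -3 → τ • s = -s)
    (hi : ∀ z : AlgebraicClosure ℚ, z ^ 4 = 1 → τ • z = z)
    (ζ : AlgebraicClosure ℚ) (hζ : IsPrimitiveRoot ζ 12) : τ • ζ = ζ ^ 5 := by
  have h12 : ζ ^ 12 = 1 := hζ.pow_eq_one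
  have hω1 : ζ ^ 4 ≠ 1 := fun h => by
    have := (hζ.pow_eq_one_iff_dvd 4).mp h
    omega
  have hquad : (ζ ^ 4) ^ 2 + ζ ^ 4 + 1 = 0 := by
    have h0 : (ζ ^ 4 - 1) * ((ζ ^ 4) ^ 2 + ζ ^ 4 + 1) = 0 := by
      have : (ζ ^ 4) ^ 3 = 1 := by rw [← pow_mul]; exact h12
      linear_combination this
    exact (mul_eq_zero.mp h0).resolve_left (sub_ne_zero.mpr hω1)
  have hsq : (ζ ^ 4 + ζ ^ 4 + 1) ^ 2 = -3 := by linear_combination 4 * hquad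
  have H1 := hs _ hsq
  rw [smul_add, smul_add, smul_one] at H1
  have hτω : τ • ζ ^ 4 = (ζ ^ 4) ^ 2 := by
    linear_combination (1 / 2 : AlgebraicClosure ℚ) * H1 - hquad
  have hτ9 : τ • ζ ^ 9 = ζ ^ 9 := hi _ (by
    rw [← pow_mul, show 9 * 4 = 12 * 3 by norm_num, pow_mul, h12, one_pow])
  have hζ13 : ζ ^ 9 * ζ ^ 4 = ζ := by
    rw [← pow_add, show 9 + 4 = 12 + 1 by norm_num, pow_add, h12, one_mul, pow_one]
  calc τ • ζ = τ • (ζ ^ 9 * ζ ^ 4) := by rw [hζ13]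
    _ = ζ ^ 9 * (ζ ^ 4) ^ 2 := by rw [smul_mul', hτ9, hτω]
    _ = ζ ^ 5 := by
        rw [← pow_mul, ← pow_add, show 9 + 4 * 2 = 12 + 5 by norm_num, pow_add, h12, one_mul]

/-- **G3 (M, g3 with `𝔠₄(t₁,1) ≠ 0` for `𝔇(t₁,1) ≠ 0`): Chebotarev.**  `t₁ ∈ ℚ̄` a root of
`𝔠₆(c₄,c₆;·,1)` with `𝔠₄(t₁,1) ≠ 0`, `σ ∈ Γ_ℚ`
fixing `t₁` and acting on `μ₁₂` by `5`.  The tree's PROVED `exists_isArithFrobAt_mul_inv_mem_not_mem`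
(open subgroup = pointwise stabiliser of the `Γ_ℚ`-orbits of `t₁` and `ζ₁₂`) gives `ℓ ∉ S` and a
Frobenius `φ` at `𝔓 ∣ ℓ` in `σN`: `φ t₁ = t₁ ⇒ t₁ ≡ t̄ ∈ 𝔽_ℓ (mod 𝔓)`, `φ ζ₁₂ = ζ₁₂⁵ ⇒ ℓ ≡ 5 (12)`;
enlarging `S` by the primes dividing `17424·240·N_{ℚ(t₁)/ℚ}(𝔠₄(t₁,1))` (numerator and
denominator) and the denominators of `t₁`'s minimal polynomial keeps `t̄` integral and `𝔠₄(t̄) ≠ 0`.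
[Neukirch ANT VII.13.4; tree `ChebotarevOpenSubgroup`] -/
theorem exists_prime_five_mod_twelve_root (c₄ c₆ : ℤ) (hc : c₄ ^ 3 ≠ c₆ ^ 2)
    (t₁ ζ : AlgebraicClosure ℚ) (h6 : C6 (c₄ : AlgebraicClosure ℚ) c₆ t₁ 1 = 0)
    (h4 : C4 (c₄ : AlgebraicClosure ℚ) c₆ t₁ 1 ≠ 0) (hζ : IsPrimitiveRoot ζ 12)
    (σ : Field.absoluteGaloisGroup ℚ) (hσt : σ • t₁ = t₁) (hσζ : σ • ζ = ζ ^ 5) (S : Finset ℕ) :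
    ∃ (ℓ : ℕ) (_ : Fact ℓ.Prime), ℓ ∉ S ∧ ℓ % 12 = 5 ∧
      ∃ t : ℤ, C6 (c₄ : ZMod ℓ) (c₆ : ZMod ℓ) (t : ZMod ℓ) 1 = 0 ∧
        C4 (c₄ : ZMod ℓ) (c₆ : ZMod ℓ) (t : ZMod ℓ) 1 ≠ 0 := by
  sorry

/-- **G2 (S, NEW FORM — replaces g3's G2 + k1's L6/L6a): the member has an INTEGRAL short model whose
reduction is read off `𝔠₄, 𝔠₆ (mod ℓ)`.**  With `v := 17424·240 = 2⁸3³5·11²`: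
`⟨v⁻¹,0,0,0⟩ • E_{t,1} = E_{A,B}`, `A = 27·17424³·240⁴·(𝔇_λλ𝔇_μμ − 𝔇_λμ²)(c₄,c₆,t,1) ∈ ℤ`,
`B = 54·17424⁵·240⁵·(𝔇_λ M − 𝔇_μ L)(c₄,c₆,t,1) ∈ ℤ` (`scale_smul_short`; the `𝔇`-derivatives are
polynomials over `ℤ`, `C4 = −(…)/17424`, `C6 = (…)/240` with `C4l, C4m = −(…)/17424`), and for
`ℓ ∉ {2,3,5,11}` the constants are `ℓ`-units, so `A ≡ 0 ↔ 𝔠₄ ≡ 0`, `B ≡ 0 ↔ 𝔠₆ ≡ 0 (mod ℓ)`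
(`map_{D…}` cast lemmas by `simp [Dll, …]; push_cast; ring`). [Fisher2012Hessian §8; SilvermanAEC2009 III.1] -/
theorem member_integral_short_mod (ℓ : ℕ) [Fact ℓ.Prime] (hℓ : ℓ ∉ ({2, 3, 5, 11} : Finset ℕ))
    (c₄ c₆ t : ℤ) :
    ∃ (A B : ℤ) (Cv : VariableChange ℚ),
      Cv • member c₄ c₆ t 1 = shortWeierstrass (A, B) ∧
      ((A : ZMod ℓ) = 0 ↔ C4 (c₄ : ZMod ℓ) (c₆ : ZMod ℓ) (t : ZMod ℓ) 1 = 0) ∧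
      ((B : ZMod ℓ) = 0 ↔ C6 (c₄ : ZMod ℓ) (c₆ : ZMod ℓ) (t : ZMod ℓ) 1 = 0) := by
  sorry

open Literature.NumberTheory.QuadraticFields.GaussianPrimary GaussianQuartic in
/-- **N3 (S, NEW, PROVED): `3 ∤ #E(𝔽_ℓ)` for `E : y² = x³ + ax`, `a ≠ 0`, `ℓ ≡ 5 (mod 12)`.**
Gauss / Ireland–Rosen 18 §4 Thm 5 (tree PROVED `IrelandRosen1990_card_points_one_mod_four_holds`):
`#E(𝔽_ℓ) = ℓ + 1 − 2 Re π'`, `π' ∈ ℤ[i]`, `N(π') = ℓ`; `ℓ ≡ 2 (mod 3)` forces `3 ∤ Re π'`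
(`x² + y² ≡ 2 (3) ⇒ x ≢ 0`), and `3 ∣ ℓ + 1`.  (Elementary alternative: a point of order `3` would
give `Ψ₃ = 3x⁴ + 6ax² − a² = 0`, i.e. `3(x²+a)² = (2a)²`, but `(3/ℓ) = −1`.)
[IrelandRosen1990 Ch. 18 §4 Thm 5; numerics `num/n3_check.py`: 0/3476 exceptions, `ℓ < 400`] -/
theorem not_three_dvd_natCard_j1728 {p : ℕ} [Fact p.Prime] (hp12 : p % 12 = 5) (a : ZMod p)
    (ha : a ≠ 0) : ¬ 3 ∣ Nat.card (⟨0, 0, 0, a, 0⟩ : WeierstrassCurve (ZMod p)).toAffine.Point := by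
  have hp : p.Prime := Fact.out
  have hp1 : p % 4 = 1 := by omega
  -- `a = -D̄`, `p ∤ D`
  set D : ℤ := -((a.val : ℤ)) with hD
  have hDp : (D : ZMod p) = -a := by rw [hD]; push_cast; rw [ZMod.natCast_zmod_val]
  have hDnd : ¬ (p : ℤ) ∣ D := by
    rw [← ZMod.intCast_zmod_eq_zero_iff_dvd, hDp, neg_eq_zero]; exact ha
  have hW : (⟨0, 0, 0, a, 0⟩ : WeierstrassCurve (ZMod p)) = ⟨0, 0, 0, -(D : ZMod p), 0⟩ := by
    rw [hDp, neg_neg]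
  -- a primary `π` of norm `p`
  obtain ⟨u, v, huv⟩ := Nat.Prime.sq_add_sq (p := p) (by omega)
  set π₀ : GaussianInt := ⟨u, v⟩ with hπ₀
  have hπ₀p : π₀.norm = p := by
    rw [Zsqrtd.norm_def, hπ₀]; push_cast; rw [← huv]; push_cast; ring
  have hpar : (π₀.re + π₀.im) % 2 = 1 := by
    rw [← norm_emod_two, hπ₀p]; exact_mod_cast (show (p : ℤ) % 2 = 1 by omega)
  set π : GaussianInt := primary π₀ with hπ
  have hπP : IsPrimary π := isPrimary_primary hpar
  have hπp : π.norm = p := by rw [hπ, norm_primary hpar, hπ₀p]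
  have hπ1 : (⟨2, 2⟩ : GaussianInt) ∣ π - 1 := (isPrimary_iff_dvd π).mp hπP
  -- `χ_π(D) = i^k`
  have hD0 : ((D : ℤ) : ZMod p) ≠ 0 := by rwa [Ne, ZMod.intCast_zmod_eq_zero_iff_dvd]
  obtain ⟨k, hk⟩ : ∃ k : ℕ, chi hp1 hπp (D : ZMod p) = ⟨0, 1⟩ ^ k := by
    rcases eq_of_isUnit (isUnit_chi hp1 hπp hD0) with h | h | h | h
    · exact ⟨0, by rw [h, pow_zero]⟩
    · exact ⟨2, by rw [h]; decide⟩
    · exact ⟨1, by rw [h, pow_one]⟩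
    · exact ⟨3, by rw [h]; decide⟩
  have hkdvd : π ∣ (D : GaussianInt) ^ ((p - 1) / 4) - ⟨0, 1⟩ ^ k := by
    apply dvd_of_red_eq_zero hπp
    have hred := (chi_eq_iff hp1 hπp hD0 (isUnit_I.pow k)).mp hk
    rw [map_sub, map_pow, map_intCast, show (p - 1) / 4 = p / 4 by omega, ← hred, sub_self]
  -- Ireland–Rosen 18.5: `N = p + 1 - 2 Re π'`, `N(π') = p`
  have hN := IrelandRosen1990_card_points_one_mod_four_holds hp1 hDnd hπp hπ1 hkdvd
  rw [← hW] at hN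
  set π' : GaussianInt := star ((⟨0, 1⟩ : GaussianInt) ^ k) * π with hπ'
  have hu' : IsUnit (star ((⟨0, 1⟩ : GaussianInt) ^ k)) := (isUnit_I.pow k).star
  have hπ'p : π'.norm = p := by
    rw [hπ', Zsqrtd.norm_mul, (Zsqrtd.norm_eq_one_iff' (by norm_num) _).mpr hu', one_mul, hπp]
  have hnorm : π'.re * π'.re + π'.im * π'.im = p := by
    have h := hπ'p
    rw [Zsqrtd.norm_def] at h
    linear_combination h
  -- reduce everything mod 3
  rintro ⟨c, hc⟩
  set N := Nat.card (⟨0, 0, 0, a, 0⟩ : WeierstrassCurve (ZMod p)).toAffine.Point with hNdef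
  have hp3 : (p : ZMod 3) = 2 := by
    have h := ZMod.natCast_mod p 3
    rw [show p % 3 = 2 by omega] at h
    exact_mod_cast h.symm
  have e1 : ((π'.re : ℤ) : ZMod 3) * (π'.re : ZMod 3) + (π'.im : ZMod 3) * (π'.im : ZMod 3) = 2 := by
    have := congrArg (Int.cast : ℤ → ZMod 3) hnorm
    push_cast at this
    rw [hp3] at this
    exact this
  have e2 : (3 : ZMod 3) * (c : ZMod 3) = 2 + 1 - 2 * (π'.re : ZMod 3) := by
    have := congrArg (Int.cast : ℤ → ZMod 3) hN
    rw [hc] at this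
    push_cast at this
    rw [hp3] at this
    exact this
  have fin : ∀ X Y C : ZMod 3, X * X + Y * Y = 2 → 3 * C = 2 + 1 - 2 * X → False := by decide
  exact fin _ _ _ e1 e2

/-- **F2 = k1's gen-2 atom `FrobeniusCertificate` (M), VERBATIM** — the ONE shared tail helper of k1 and k3.
A good prime `q ≡ 2 (mod 3)` with `3 ∤ a_q` makes every framed `ρ̄_{E,3}` absolutely irreducible over
`ℚ(√-3)`: `Frob_q` has `det = q̄ = −1` and `tr = ā_q ≠ 0` in `GL₂(𝔽₃)`, hence order `8` (`g² = tg + 1`,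
`g⁴ = −1`); tree PROVED `trace_galoisRepTorsion_frobenius_eq`, `det_galoisRepTorsion_frobenius_eq`,
`det_eq_modPCyclotomicCharacter_of_isTorsionGaloisRep_holds` and
`Theorems.isAbsIrreducibleOverSqrt_negThree_of_orderOf_eq_eight`; template = the tree's PROVED
`exists_orderOf_eq_eight_of_dvd_frobeniusTrace` (supersingular analogue).
[Manoharmayum1999 Prop 2.3.3; ConradDiamondTaylor1999 p. 556; Serre1972 §2.8] -/
def FrobeniusCertificate : Prop :=
  ∀ (W : WeierstrassCurve ℚ) [W.IsElliptic] [W.IsGloballyMinimal] (q : ℕ) [Fact q.Prime],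
    q % 3 = 2 → W.HasGoodReductionAtPrime q → ¬ (3 : ℤ) ∣ W.frobeniusTrace q →
    ∀ ρ₃ : ModPGaloisRep ℚ (ZMod 3) 2, W.IsTorsionGaloisRep 3 ρ₃ → ρ₃.IsAbsIrreducibleOverSqrt (-3)

/-- G6a (XS, verbatim g3): an integral rescaling of `(c₄, c₆)`. -/
theorem exists_integral_scaling (x y : ℚ) :
    ∃ (u : ℤ) (c₄ c₆ : ℤ), u ≠ 0 ∧ (c₄ : ℚ) = (u : ℚ) ^ 4 * x ∧ (c₆ : ℚ) = (u : ℚ) ^ 6 * y := by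
  sorry

/-- G6b (XS, verbatim g3): the rescaled `c₄c₆`-model is isomorphic to `W`
(`fisherChange_smul`, `scale_smul_short`). -/
theorem base_scaled (W : WeierstrassCurve ℚ) [W.IsElliptic] {u c₄ c₆ : ℤ} (hu : u ≠ 0)
    (h4 : (c₄ : ℚ) = (u : ℚ) ^ 4 * W.c₄) (h6 : (c₆ : ℚ) = (u : ℚ) ^ 6 * W.c₆) :
    ∃ Cv : VariableChange ℚ, Cv • W = base c₄ c₆ := by
  sorry

/-- G6c (PROVED, Dirichlet: `Nat.forall_exists_prime_gt_and_eq_mod`). -/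
theorem exists_prime_five_mod_twelve_gt (n : ℕ) : ∃ ℓ : ℕ, ℓ.Prime ∧ n < ℓ ∧ ℓ % 12 = 5 := by
  have h5 : IsUnit ((5 : ℕ) : ZMod 12) := by decide
  obtain ⟨ℓ, hgt, hp, hmod⟩ := Nat.forall_exists_prime_gt_and_eq_mod h5 n
  refine ⟨ℓ, hp, hgt, ?_⟩
  have := (ZMod.natCast_eq_natCast_iff' ℓ 5 12).1 hmod
  simpa using this

/-! ## §4 The ORDER-8 TAIL (PROVED from N3 + tree theorems, F2 as hypothesis) -/

/-- **The tail.**  An integral short model `E_{A,B}` that is `5`-congruent to `W`, and a prime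
`ℓ ≡ 5 (12)` with `ℓ ∤ A`, `ℓ ∣ B`: then a global minimal model `W'` of `E_{A,B}` answers the stub —
`W'[5] ≅ ρ`, and every framed `W'[3]` is absolutely irreducible over `ℚ(√-3)`.  Chain (all tree,
PROVED): `hasGlobalMinimalModel_rat_holds`; `int_Δ` (`Δ ≡ −64A³ ≢ 0`);
`frobeniusTrace_eq_of_smul_eq_shortWeierstrass` (`a_ℓ(W') = ℓ + 1 − #Ē_{A,B}(𝔽_ℓ)`);
N3 (`3 ∤ #`, and `3 ∣ ℓ + 1`); `hasGoodReductionAtPrime_shortWeierstrass_of_not_dvd_Δ` +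
`hasGoodReductionAtPrime_smul_iff`; F2. -/
theorem tail (hF2 : FrobeniusCertificate) (W : WeierstrassCurve ℚ) [W.IsElliptic] (A B : ℤ)
    [(shortWeierstrass (A, B)).IsElliptic] (hEW : Congr (shortWeierstrass (A, B)) W)
    (ℓ : ℕ) [Fact ℓ.Prime] (h12 : ℓ % 12 = 5) (hA : ¬ (ℓ : ℤ) ∣ A) (hB : (ℓ : ℤ) ∣ B)
    (ρ : ModPGaloisRep ℚ (ZMod 5) 2) (hρ : W.IsTorsionGaloisRep 5 ρ) :
    ∃ (W' : WeierstrassCurve ℚ) (_ : W'.IsElliptic), W'.IsTorsionGaloisRep 5 ρ ∧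
      ∃ ρ₃' : ModPGaloisRep ℚ (ZMod 3) 2, W'.IsTorsionGaloisRep 3 ρ₃' ∧
        ρ₃'.IsAbsIrreducibleOverSqrt (-3) := by
  set E : WeierstrassCurve ℚ := shortWeierstrass (A, B) with hE
  obtain ⟨C, hmin⟩ := hasGlobalMinimalModel_rat_holds E
  haveI := hmin
  have hsmul : C⁻¹ • (C • E) = shortWeierstrass (A, B) := inv_smul_smul C E
  have hℓ1 : ℓ % 4 = 1 := by omega
  have h2 : (2 : ZMod ℓ) ≠ 0 := GaussianQuartic.two_ne_zero_of_one_mod_four hℓ1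
  have hA' : (A : ZMod ℓ) ≠ 0 := by rwa [Ne, ZMod.intCast_zmod_eq_zero_iff_dvd]
  have hB' : (B : ZMod ℓ) = 0 := by rwa [ZMod.intCast_zmod_eq_zero_iff_dvd]
  -- `ℓ ∤ Δ(A,B) = -16(4A³ + 27B²) ≡ -64A³`
  have hΔ : ¬ (ℓ : ℤ) ∣ (⟨0, 0, 0, (A, B).1, (A, B).2⟩ : WeierstrassCurve ℤ).Δ := by
    rw [int_Δ, ← ZMod.intCast_zmod_eq_zero_iff_dvd]
    push_cast
    rw [hB']
    have : (-16 : ZMod ℓ) * (4 * (A : ZMod ℓ) ^ 3 + 27 * (0 : ZMod ℓ) ^ 2) =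
        -(2 ^ 6 * (A : ZMod ℓ) ^ 3) := by ring
    rw [this, neg_eq_zero]
    exact mul_ne_zero (pow_ne_zero _ h2) (pow_ne_zero _ hA')
  -- `a_ℓ(W') = ℓ + 1 − #Ē_{A,B}(𝔽_ℓ)` and the reduction is `y² = x³ + Āx`
  have hft : (C • E).frobeniusTrace ℓ =
      Literature.NumberTheory.Automorphic.frobeniusTrace ⟨0, 0, 0, A, B⟩ ℓ :=
    frobeniusTrace_eq_of_smul_eq_shortWeierstrass (W := C • E) (AB := (A, B)) hsmul ℓ hΔ
  have hmap : (⟨0, 0, 0, A, B⟩ : WeierstrassCurve ℤ).map (Int.castRingHom (ZMod ℓ)) =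
      ⟨0, 0, 0, (A : ZMod ℓ), 0⟩ := by
    ext <;> simp [WeierstrassCurve.map, hB']
  have hN3 := not_three_dvd_natCard_j1728 (p := ℓ) h12 (A : ZMod ℓ) hA'
  have h3ft : ¬ (3 : ℤ) ∣ (C • E).frobeniusTrace ℓ := by
    rw [hft, Literature.NumberTheory.Automorphic.frobeniusTrace,
      Literature.NumberTheory.Automorphic.numPointsMod, hmap]
    intro h
    apply hN3
    have h3ℓ : (3 : ℤ) ∣ (ℓ : ℤ) + 1 := by
      have : 3 ∣ ℓ + 1 := Nat.dvd_of_mod_eq_zero (by omega)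
      exact_mod_cast Int.natCast_dvd_natCast.mpr this
    have hN := (Int.dvd_sub h3ℓ h)
    rw [sub_sub_cancel] at hN
    exact Int.natCast_dvd_natCast.mp hN
  -- good reduction at `ℓ`
  have hgood : (C • E).HasGoodReductionAtPrime ℓ :=
    (hasGoodReductionAtPrime_smul_iff E C ℓ).mpr
      (hasGoodReductionAtPrime_shortWeierstrass_of_not_dvd_Δ (AB := (A, B)) ℓ hΔ)
  have h3 : ℓ % 3 = 2 := by omega
  obtain ⟨ρ₃, hρ₃⟩ := (C • E).exists_isTorsionGaloisRep 3
  have hirr := hF2 (C • E) ℓ h3 hgood h3ft ρ₃ hρ₃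
  have hcongr : Congr (C • E) W := congr_trans (congr_symm (congr_smul E C)) hEW
  exact ⟨C • E, inferInstance, isTorsionGaloisRep_of_congr hcongr hρ, ρ₃, hρ₃, hirr⟩

/-! ## §5 Assembly: Fisher (i) + Core1728 + F2 (+ G3, G2, G6, N3) ⇒ the stub, no hypothesis at `3` -/

/-- **The line (generation 4).**  `W ↦ W♭ = base(c₄,c₆)` (G6); `c₆ = 0`: `W♭ = E_{−27c₄,0}` itself,
any Dirichlet prime `ℓ ≡ 5 (12)` above `27|c₄|`; `c₆ ≠ 0`: `Core1728 → T3 → G3 → G2 → Fisher (i)`;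
both branches end in `tail`.  NONE of the stub's hypotheses (`27 ∤ N`, no abs. irreducible `ρ̄₃`,
`ρ̄₅` abs. irreducible) is used. -/
theorem stub_switch_of_core_and_tail (hF : thm132_geomTorsionFive_of_hesseFamily)
    (hCore : Core1728) (hF2 : FrobeniusCertificate) : CDT_three_five_switch := by
  intro W _ _ _ ρ hρ _
  -- integral `c₄c₆`-model
  obtain ⟨u, c₄, c₆, hu, h4, h6⟩ := exists_integral_scaling W.c₄ W.c₆
  obtain ⟨Cv, hCv⟩ := base_scaled W hu h4 h6
  haveI hBell : (base (c₄ : ℚ) c₆).IsElliptic := by rw [← hCv]; infer_instance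
  have hcongrB : Congr (base (c₄ : ℚ) c₆) W := congr_symm (congr_of_smul_eq Cv hCv)
  have hcQ : (c₄ : ℚ) ^ 3 ≠ (c₆ : ℚ) ^ 2 := by
    intro h
    have h1728 : (1728 : ℚ) * (base (c₄ : ℚ) c₆).Δ =
        (base (c₄ : ℚ) c₆).c₄ ^ 3 - (base (c₄ : ℚ) c₆).c₆ ^ 2 := (base (c₄ : ℚ) c₆).c_relation
    have hc4 : (base (c₄ : ℚ) c₆).c₄ = 6 ^ 4 * c₄ := by
      simp only [WeierstrassCurve.c₄, WeierstrassCurve.b₂, WeierstrassCurve.b₄]; ring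
    have hc6 : (base (c₄ : ℚ) c₆).c₆ = 6 ^ 6 * c₆ := by
      simp only [WeierstrassCurve.c₆, WeierstrassCurve.b₂, WeierstrassCurve.b₄, WeierstrassCurve.b₆]; ring
    rw [hc4, hc6, mul_pow, mul_pow, h, show ((6 : ℚ) ^ 4) ^ 3 = (6 ^ 6) ^ 2 by norm_num, ← sub_mul,
      sub_self, zero_mul] at h1728
    exact (base (c₄ : ℚ) c₆).isUnit_Δ.ne_zero (by simpa using h1728)
  have hc : c₄ ^ 3 ≠ c₆ ^ 2 := fun h => hcQ (by exact_mod_cast h)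
  by_cases hc₆ : c₆ = 0
  · -- `j(W) = 1728`: `W♭ = E_{−27c₄, 0}` itself
    subst hc₆
    have hc₄ : c₄ ≠ 0 := by rintro rfl; exact hc (by norm_num)
    have hz : (-27 * c₄ : ℤ) ≠ 0 := by omega
    obtain ⟨ℓ, hℓ, hgt, h12⟩ := exists_prime_five_mod_twelve_gt (-27 * c₄).natAbs
    haveI : Fact ℓ.Prime := ⟨hℓ⟩
    have hbase : base (c₄ : ℚ) ((0 : ℤ) : ℚ) = shortWeierstrass (-27 * c₄, 0) := by
      ext <;> simp [shortWeierstrass]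
    haveI : (shortWeierstrass (-27 * c₄, 0)).IsElliptic := by rw [← hbase]; exact hBell
    have hcongrE : Congr (shortWeierstrass (-27 * c₄, 0)) W := by rw [← hbase]; exact hcongrB
    exact tail hF2 W (-27 * c₄) 0 hcongrE ℓ h12 (not_dvd_of_natAbs_lt hz hgt) (dvd_zero _) ρ hρ
  · -- generic case: the twisted `1728`-fibre (Core1728) read at a Chebotarev prime `ℓ ≡ 5 (12)`
    obtain ⟨τ, t₁, hs, hi, ht6, ht4, hfix⟩ := hCore c₄ c₆ hc hc₆
    obtain ⟨ζ, hζ⟩ := HasEnoughRootsOfUnity.exists_primitiveRoot (AlgebraicClosure ℚ) 12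
    have hτζ : τ • ζ = ζ ^ 5 := smul_zeta12 τ hs hi ζ hζ
    obtain ⟨ℓ, hℓF, hℓS, h12, t, ht6', ht4'⟩ :=
      exists_prime_five_mod_twelve_root c₄ c₆ hc t₁ ζ ht6 ht4 hζ τ hfix hτζ {2, 3, 5, 11}
    haveI := hℓF
    obtain ⟨A, B, Cv', hCv', hA4, hB6⟩ := member_integral_short_mod ℓ hℓS c₄ c₆ t
    have hA : ¬ (ℓ : ℤ) ∣ A := by
      rw [← ZMod.intCast_zmod_eq_zero_iff_dvd, hA4]; exact ht4'
    have hB : (ℓ : ℤ) ∣ B := by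
      rw [← ZMod.intCast_zmod_eq_zero_iff_dvd, hB6]; exact ht6'
    -- `E_{A,B}` is elliptic: `4A³ + 27B² ≡ 4A³ ≢ 0 (mod ℓ)`
    have hℓ1 : ℓ % 4 = 1 := by omega
    have h2 : (2 : ZMod ℓ) ≠ 0 := GaussianQuartic.two_ne_zero_of_one_mod_four hℓ1
    have hA' : (A : ZMod ℓ) ≠ 0 := by rwa [Ne, ZMod.intCast_zmod_eq_zero_iff_dvd]
    have hB' : (B : ZMod ℓ) = 0 := by rwa [ZMod.intCast_zmod_eq_zero_iff_dvd]
    have hne : 4 * (A, B).1 ^ 3 + 27 * (A, B).2 ^ 2 ≠ 0 := by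
      intro h0
      have h0' := congrArg (Int.cast : ℤ → ZMod ℓ) h0
      push_cast at h0'
      rw [hB'] at h0'
      have : (4 : ZMod ℓ) * (A : ZMod ℓ) ^ 3 + 27 * (0 : ZMod ℓ) ^ 2 = 2 ^ 2 * (A : ZMod ℓ) ^ 3 := by ring
      rw [this] at h0'
      exact mul_ne_zero (pow_ne_zero _ h2) (pow_ne_zero _ hA') h0'
    haveI hEell : (shortWeierstrass (A, B)).IsElliptic := isElliptic_of_ne_zero hne
    set E' : WeierstrassCurve ℚ := member c₄ c₆ t 1 with hE'
    haveI hE'ell : E'.IsElliptic := by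
      have : E' = Cv'⁻¹ • shortWeierstrass (A, B) := by rw [← hCv', inv_smul_smul]
      rw [this]; infer_instance
    obtain ⟨e, he⟩ := hF (base (c₄ : ℚ) c₆) E' (c₄ : ℚ) (c₆ : ℚ) (t : ℚ) 1 rfl rfl
    have hcongrE : Congr (shortWeierstrass (A, B)) W :=
      congr_trans (congr_symm (congr_of_smul_eq Cv' hCv')) (congr_trans ⟨e, he⟩ hcongrB)
    exact tail hF2 W A B hcongrE ℓ h12 hA hB ρ hρ


/-! ## §6 The G4″ split (gen 4): the one L-sized helper of the core becomes M + S + S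

g3's `exists_root_C6_fixed_of_conj` (L) is cut into three prover-sized statements whose
composition is PROVED below; the named fact `Thm132iiMemHesseFamily` (Fisher 13.2 (ii) over a
field `K ⊆ ℚ̄`, verbatim g3 — to be vendored; k1's L4b′ is the same theorem over number fields)
is consumed ONLY in G4c. -/

/-- Named fact (verbatim g3): Fisher 13.2 (ii) over an intermediate field `K ⊆ ℚ̄`.
[Fisher2012Hessian Thm 13.2 (ii); RubinSilverberg1995 Thm 4.1/5.1] -/
def Thm132iiMemHesseFamily : Prop :=
  ∀ (E E' : WeierstrassCurve ℚ) [E.IsElliptic] [E'.IsElliptic] (c₄ c₆ : ℚ)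
    (K : IntermediateField ℚ (AlgebraicClosure ℚ)),
    E = ⟨0, 0, 0, -27 * c₄, -54 * c₆⟩ →
    (∃ e : E'.geomTorsion 5 ≃+ E.geomTorsion 5,
      (∀ σ : Field.absoluteGaloisGroup ℚ, (∀ x : AlgebraicClosure ℚ, x ∈ K → σ • x = x) →
        ∀ P : E'.geomTorsion 5, e (σ • P) = σ • e P) ∧
      ∀ P Q : E'.geomTorsion 5,
        weilPairingFun (W := E) (m := 5) (by norm_num) (e P : E.geomPoints) (e Q) =
          weilPairingFun (W := E') (m := 5) (by norm_num) (P : E'.geomPoints) Q) →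
    ∃ (l m : AlgebraicClosure ℚ), l ∈ K ∧ m ∈ K ∧ (l ≠ 0 ∨ m ≠ 0) ∧
      ∃ Cv : VariableChange (AlgebraicClosure ℚ),
        Cv • E'.map (algebraMap ℚ (AlgebraicClosure ℚ)) =
          ⟨0, 0, 0, -27 * C4 (c₄ : AlgebraicClosure ℚ) c₆ l m, -54 * C6 (c₄ : AlgebraicClosure ℚ) c₆ l m⟩

/-- The subgroup of `Γ_ℚ` on which an additive isomorphism `e : E'[5] ≃ E[5]` is equivariant
(an equaliser of two actions, hence a subgroup). -/
def eqvSubgroup {E E' : WeierstrassCurve ℚ} (e : E'.geomTorsion 5 ≃+ E.geomTorsion 5) :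
    Subgroup (Field.absoluteGaloisGroup ℚ) where
  carrier := {γ | ∀ P : E'.geomTorsion 5, e (γ • P) = γ • e P}
  one_mem' := fun P => by rw [one_smul, one_smul]
  mul_mem' := fun {a b} ha hb P => by
    simp only [Set.mem_setOf_eq] at ha hb
    rw [mul_smul, ha, hb, mul_smul]
  inv_mem' := fun {a} ha P => by
    simp only [Set.mem_setOf_eq] at ha
    have h := ha (a⁻¹ • P)
    rw [smul_inv_smul] at h
    rw [h, inv_smul_smul]

theorem mem_eqvSubgroup_iff {E E' : WeierstrassCurve ℚ} (e : E'.geomTorsion 5 ≃+ E.geomTorsion 5)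
    (γ : Field.absoluteGaloisGroup ℚ) : γ ∈ eqvSubgroup e ↔ ∀ P : E'.geomTorsion 5, e (γ • P) = γ • e P :=
  Iff.rfl

/-- **G4a (M): frames ⇒ a symplectic isomorphism equivariant at `σ`.**  From framings
`e₁ : E[5] ≃ 𝔽₅²` (`ρ̄`), `e₁' : E'[5] ≃ 𝔽₅²` (`ρ̄'`) and matrices `C` of EVERY determinant with
`C ρ̄'(σ) = ρ̄(σ) C`: `e := e₁⁻¹ ∘ C ∘ e₁'` is equivariant at `σ`, and `e₅^E(eP, eQ) = ζ_E^{det C·[P,Q]}`,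
`e₅^{E'}(P,Q) = ζ_{E'}^{[P,Q]}` with `ζ_{E'} = ζ_E^k` (both pairings alternating, bilinear,
non-degenerate, `μ₅`-valued: tree PROVED `weilPairingFun_add_left/right`, `weilPairingFun_self`,
`weilPairingFun_pow`, `eq_zero_of_weilPairingFun_eq_one`), so `det C := k` makes `e` symplectic.
[SilvermanAEC2009 III.8.1; Fisher2012Hessian §13] -/
theorem exists_symplectic_equivariant_at (E E' : WeierstrassCurve ℚ) [E.IsElliptic] [E'.IsElliptic]
    (ρ ρ' : ModPGaloisRep ℚ (ZMod 5) 2) (hρ : E.IsTorsionGaloisRep 5 ρ)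
    (hρ' : E'.IsTorsionGaloisRep 5 ρ') (σ : Field.absoluteGaloisGroup ℚ)
    (hconj : ∀ k : (ZMod 5)ˣ, ∃ C : GL (Fin 2) (ZMod 5),
      Matrix.GeneralLinearGroup.det C = k ∧ C * ρ' σ = ρ σ * C) :
    ∃ e : E'.geomTorsion 5 ≃+ E.geomTorsion 5, σ ∈ eqvSubgroup e ∧
      ∀ P Q : E'.geomTorsion 5,
        weilPairingFun (W := E) (m := 5) (by norm_num) (e P : E.geomPoints) (e Q) =
          weilPairingFun (W := E') (m := 5) (by norm_num) (P : E'.geomPoints) Q := by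
  sorry

/-- **G4b (S → PROVED here): Galois correspondence for the equivariance subgroup.**  `eqvSubgroup e` contains the
open subgroup `Γ_{ℚ(E[5])} ∩ Γ_{ℚ(E'[5])}` (tree PROVED `isOpen_fixingSubgroupOfModule_geomTorsion`),
hence is open, hence closed (`Subgroup.isClosed_of_isOpen`), so it is the fixing subgroup of its fixed
field (`InfiniteGalois.fixingSubgroup_fixedField`; tree `fixingSubgroup_fixedField_eq`). [folklore] -/
theorem mem_eqvSubgroup_of_fixes {E E' : WeierstrassCurve ℚ} [E.IsElliptic] [E'.IsElliptic]
    (e : E'.geomTorsion 5 ≃+ E.geomTorsion 5) (γ : Field.absoluteGaloisGroup ℚ)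
    (hγ : ∀ x : AlgebraicClosure ℚ, x ∈ IntermediateField.fixedField (eqvSubgroup e) → γ • x = x) :
    γ ∈ eqvSubgroup e := by
  have hle : (fixingSubgroupOfModule ℚ (E.geomTorsion 5)) ⊓ (fixingSubgroupOfModule ℚ (E'.geomTorsion 5)) ≤
      eqvSubgroup e := by
    intro δ hδ P
    have h1 := (E'.mem_fixingSubgroupOfModule_geomTorsion_iff 5).mp hδ.2 P
    have h2 := (E.mem_fixingSubgroupOfModule_geomTorsion_iff 5).mp hδ.1 (e P)
    rw [h1, h2]
  have hopen : IsOpen (eqvSubgroup e : Set (Field.absoluteGaloisGroup ℚ)) :=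
    Subgroup.isOpen_mono hle
      ((E.isOpen_fixingSubgroupOfModule_geomTorsion 5).inter
        (E'.isOpen_fixingSubgroupOfModule_geomTorsion 5))
  have hclosed : IsClosed (eqvSubgroup e : Set (Field.absoluteGaloisGroup ℚ)) :=
    Subgroup.isClosed_of_isOpen _ hopen
  have hfix : (IntermediateField.fixedField (eqvSubgroup e)).fixingSubgroup = eqvSubgroup e :=
    InfiniteGalois.fixingSubgroup_fixedField ⟨eqvSubgroup e, hclosed⟩
  have hmem : γ ∈ (IntermediateField.fixedField (eqvSubgroup e)).fixingSubgroup :=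
    (IntermediateField.mem_fixingSubgroup_iff _ _).mpr fun x hx => hγ x hx
  exact (Subgroup.ext_iff.mp hfix γ).mp hmem

/-- **G4c (S): reading the Hesse parameters.**  Apply `Thm132iiMemHesseFamily` over `K`:
`E' ≅_{ℚ̄} E_{l,m}` with `l, m ∈ K`; `c₆(E') = 0 ⇒ c₆(E_{l,m}) = 6⁶𝔠₆(l,m) = 0`
(`variableChange_c₆`, `map_c₆`), `c₄(E') ≠ 0` (`c₄³ = 1728Δ`) `⇒ 𝔠₄(l,m) ≠ 0`; `m ≠ 0` (else
`𝔠₆(l,0) = l³⁰c₆ ≠ 0`, `C6_one_zero` + homogeneity); `t₁ := l/m ∈ K`: `𝔠₆(t₁,1) = m⁻³⁰𝔠₆(l,m) = 0`,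
`𝔠₄(t₁,1) = m⁻²⁰𝔠₄(l,m) ≠ 0` (homogeneity of the degree-`30`/`20` forms), and `σ` fixes `K ∋ l, m`.
[Fisher2012Hessian Thm 13.2, §8] -/
theorem exists_fixed_root_of_memHesse (hFii : Thm132iiMemHesseFamily) (c₄ c₆ : ℤ) (h6 : c₆ ≠ 0)
    [(base (c₄ : ℚ) c₆).IsElliptic] (E' : WeierstrassCurve ℚ) [E'.IsElliptic] (hj : E'.c₆ = 0)
    (K : IntermediateField ℚ (AlgebraicClosure ℚ))
    (e : E'.geomTorsion 5 ≃+ (base (c₄ : ℚ) c₆).geomTorsion 5)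
    (hKe : ∀ γ : Field.absoluteGaloisGroup ℚ, (∀ x : AlgebraicClosure ℚ, x ∈ K → γ • x = x) →
      ∀ P : E'.geomTorsion 5, e (γ • P) = γ • e P)
    (hweil : ∀ P Q : E'.geomTorsion 5,
      weilPairingFun (W := base (c₄ : ℚ) c₆) (m := 5) (by norm_num)
          (e P : (base (c₄ : ℚ) c₆).geomPoints) (e Q) =
        weilPairingFun (W := E') (m := 5) (by norm_num) (P : E'.geomPoints) Q)
    (σ : Field.absoluteGaloisGroup ℚ) (hσK : ∀ x : AlgebraicClosure ℚ, x ∈ K → σ • x = x) :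
    ∃ t₁ : AlgebraicClosure ℚ, C6 (c₄ : AlgebraicClosure ℚ) c₆ t₁ 1 = 0 ∧
      C4 (c₄ : AlgebraicClosure ℚ) c₆ t₁ 1 ≠ 0 ∧ σ • t₁ = t₁ := by
  sorry

/-- **G4″ (PROVED from G4a + G4b + G4c)** — g3's `exists_root_C6_fixed_of_conj` with the `𝔠₄ ≠ 0`
clause; g3's kernel-checked `exists_fixed_root_1728` then yields `Core1728` from T0, T1, T2 and this. -/
theorem exists_root_C6_fixed_of_conj (hFii : Thm132iiMemHesseFamily) (c₄ c₆ : ℤ) (h6 : c₆ ≠ 0)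
    [(base (c₄ : ℚ) c₆).IsElliptic] (E' : WeierstrassCurve ℚ) [E'.IsElliptic] (hj : E'.c₆ = 0)
    (ρ ρ' : ModPGaloisRep ℚ (ZMod 5) 2) (hρ : (base (c₄ : ℚ) c₆).IsTorsionGaloisRep 5 ρ)
    (hρ' : E'.IsTorsionGaloisRep 5 ρ') (σ : Field.absoluteGaloisGroup ℚ)
    (hconj : ∀ k : (ZMod 5)ˣ, ∃ C : GL (Fin 2) (ZMod 5),
      Matrix.GeneralLinearGroup.det C = k ∧ C * ρ' σ = ρ σ * C) :
    ∃ t₁ : AlgebraicClosure ℚ, C6 (c₄ : AlgebraicClosure ℚ) c₆ t₁ 1 = 0 ∧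
      C4 (c₄ : AlgebraicClosure ℚ) c₆ t₁ 1 ≠ 0 ∧ σ • t₁ = t₁ := by
  obtain ⟨e, hσ, hweil⟩ := exists_symplectic_equivariant_at (base (c₄ : ℚ) c₆) E' ρ ρ' hρ hρ' σ hconj
  refine exists_fixed_root_of_memHesse hFii c₄ c₆ h6 E' hj (IntermediateField.fixedField (eqvSubgroup e))
    e (fun γ hγ => (mem_eqvSubgroup_iff e γ).mp (mem_eqvSubgroup_of_fixes e γ hγ)) hweil σ ?_
  intro x hx
  exact (IntermediateField.mem_fixedField_iff (eqvSubgroup e) x).mp hx σ hσ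

/-- sanity: the stub is literally the route's named fact. -/
example : CDT_three_five_switch ↔
    (∀ (W : WeierstrassCurve ℚ) [W.IsElliptic], ¬ 27 ∣ W.conductorNorm ℤ →
      (∀ ρ₃ : ModPGaloisRep ℚ (ZMod 3) 2, W.IsTorsionGaloisRep 3 ρ₃ → ¬ ρ₃.IsAbsIrreducibleOverSqrt (-3)) →
      ∀ (ρ : ModPGaloisRep ℚ (ZMod 5) 2), W.IsTorsionGaloisRep 5 ρ → ρ.IsAbsIrreducibleOverSqrt 5 →
        ∃ (W' : WeierstrassCurve ℚ) (_ : W'.IsElliptic), W'.IsTorsionGaloisRep 5 ρ ∧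
          ∃ ρ₃' : ModPGaloisRep ℚ (ZMod 3) 2, W'.IsTorsionGaloisRep 3 ρ₃' ∧
            ρ₃'.IsAbsIrreducibleOverSqrt (-3)) := Iff.rfl

end

end Summit.ABC.ABC.Cruxes.FreyModularity.StubSwitchK3g4
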